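import Literature.MathematicalPhysics.QuantumManyBody.PeriodicClusteringFromKyFanGap
import Literature.MathematicalPhysics.QuantumManyBody.PeriodicFeynmanKacFreeForm
import Literature.MathematicalPhysics.QuantumManyBody.PeriodicBoseGasEq317
import Summits.AtomisticToContinuum.BoseEinsteinCondensation.Theorems.BECLatticeDepthHomotopyModeIdentificationSchurBound
import HarnessLib

/-!
# Route `BECLatticeDepthHomotopy`, support item `ModeIdentification` (stmt-AtomisticToContinuum-12408):
# the centre-of-mass average of a non-negative periodic state

Helper file (supports, does not close, stmt-AtomisticToContinuum-12408). The mode identification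
`Λ(0) ≤ periodicCondensateNumber` at fixed `(N, L)` needs a comparison state that is continuous,
non-negative, `Lℤ³`-periodic in every particle AND invariant under common translations
`X ↦ X + (u, …, u)` of all particles (then its one-particle density matrix has the constant mode on
top, `maxOccupation_indicator_le_condensateOccupation`). For bounded pair potentials the unique
Feynman–Kac ground state is such a state; in general (hard cores) no ground-state VECTOR is at hand,
and the comparison state is manufactured here from an arbitrary non-negative continuous periodic
`g` (in the application: a non-negative near-minimiser) by averaging over the centre of mass,

  `A(X) = L⁻³ ∫_{[0,L)³} g(X + (u, …, u)) du`.

`exists_diagonalAverage`: `A` is continuous, real non-negative, periodic, EXACTLY invariant under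
common translations (the `u`-integrand is `Lℤ³`-periodic, so the shifted cell integral is the cell
integral, `setIntegral_cellN_comp_add_of_periodic`), and — the one estimate needed downstream —
Jensen's inequality in `L²(cell)`: for every continuous `h` and every bound `C` with
`∫_cell |h - g(· + (u,…,u))|² ≤ C` for all `u`, also `∫_cell |h - A|² ≤ C` (Cauchy–Schwarz in `u`,
Tonelli). With `h = 0` this is `‖A‖ ≤ sup_u ‖g(· + u)‖ = ‖g‖`; with `h = g` it says that `A` is as
close to `g` as the translates of `g` are.

References: O. Penrose, L. Onsager, Phys. Rev. 104 (1956) 576, §4 [PenroseOnsager1956];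
E. H. Lieb, R. Seiringer, J. P. Solovej, J. Yngvason (2005), §1.2 (1.17)–(1.19) [LSSY2005].
-/

noncomputable section

namespace Summit.AtomisticToContinuum.BoseEinsteinCondensation.Theorems.ModeIdentification

open MeasureTheory Filter Metric
open scoped ENNReal NNReal Topology ComplexConjugate
open Literature.MathematicalPhysics.QuantumManyBody.BoseGas

variable {N : ℕ} {L : ℝ}

/-! ### Diagonal translations and periodicity -/

/-- A function periodic in every particle is invariant under the COMMON lattice translation
`X ↦ X + (Le_k, …, Le_k)` (sum of the `N` generators). [folklore] -/
theorem apply_add_const_single_of_periodic {β : Type*} {g : Config N → β}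
    (hper : ∀ (X : Config N) (i : Fin N) (k : Fin 3),
      g (X + Pi.single i (EuclideanSpace.single k L)) = g X)
    (X : Config N) (k : Fin 3) :
    g (X + fun _ => EuclideanSpace.single k L) = g X := by
  have hsum : (fun _ : Fin N => EuclideanSpace.single k L) =
      ∑ i : Fin N, Pi.single i (EuclideanSpace.single k L) :=
    (Finset.univ_sum_single _).symm
  rw [hsum]
  suffices h : ∀ s : Finset (Fin N),
      g (X + ∑ i ∈ s, Pi.single i (EuclideanSpace.single k L)) = g X from h _
  intro s
  induction s using Finset.induction_on with
  | empty => simp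
  | insert a s ha ih =>
      rw [Finset.sum_insert ha, add_comm (Pi.single a _) _, ← add_assoc, hper, ih]

/-- The diagonal embedding of the one-particle cell variable: `U ↦ (U 0, …, U 0)`. Adding a lattice
generator to `U` adds the common lattice translation. [folklore] -/
theorem const_apply_add_single (U : Config 1) (k : Fin 3) (L : ℝ) :
    (fun _ : Fin N => ((U + Pi.single (0 : Fin 1) (EuclideanSpace.single k L) : Config 1) 0)) =
      (fun _ : Fin N => U 0) + fun _ => EuclideanSpace.single k L := by
  funext i
  simp

/-! ### Continuity of cell integrals depending on a parameter -/

/-- A jointly continuous integrand integrates over the (bounded) one-particle cell to a continuous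
function of the parameter (dominated convergence with a local uniform bound; the cell lies in a
compact ball). [folklore] -/
theorem continuous_setIntegral_cellN_one {f : Config N → Config 1 → ℂ}
    (hf : Continuous (Function.uncurry f)) (L : ℝ) :
    Continuous fun X => ∫ U in cellN 1 L, f X U := by
  rw [continuous_iff_continuousAt]
  intro X₀
  obtain ⟨K, hK, hKn⟩ := exists_compact_mem_nhds X₀
  have hB : IsCompact (closedBall (0 : Config 1) (2 * |L|)) := isCompact_closedBall _ _
  obtain ⟨M, hM⟩ := (hK.prod hB).bddAbove_image hf.norm.continuousOn
  refine continuousAt_of_dominated (bound := fun _ => M) ?_ ?_ ?_ ?_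
  · filter_upwards with X
    exact (hf.comp (continuous_const.prodMk continuous_id)).aestronglyMeasurable
  · filter_upwards [hKn] with X hX
    rw [ae_restrict_iff' (measurableSet_cellN 1 L)]
    filter_upwards with U hU
    exact hM (Set.mem_image_of_mem _ (Set.mk_mem_prod hX (cellN_subset_closedBall 1 L hU)))
  · refine integrableOn_const ?_
    rw [volume_cellN]
    exact ENNReal.pow_ne_top (ENNReal.pow_ne_top ENNReal.ofReal_ne_top)
  · filter_upwards with U
    exact (hf.comp (continuous_id.prodMk continuous_const)).continuousAt

/-! ### The centre-of-mass average -/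

/-- **The centre-of-mass average of a non-negative continuous periodic state.** Let `L > 0` and let
`g : (ℝ³)^N → ℂ` be continuous, pointwise a non-negative real (`g = |g|`), and `Lℤ³`-periodic in
every particle. Then there is `A : (ℝ³)^N → ℂ` — namely `A(X) = L⁻³ ∫_{[0,L)³} g(X + (u,…,u)) du` —
which is continuous, pointwise a non-negative real, `Lℤ³`-periodic in every particle, invariant
under every common translation `X ↦ X + (u, …, u)`, and satisfies Jensen's inequality in
`L²(cell)` against every continuous `h`: if `∫_{[0,L)^{3N}} |h - g(· + (u,…,u))|² ≤ C` for all
`u ∈ ℝ³`, then `∫_{[0,L)^{3N}} |h - A|² ≤ C`. [folklore] -/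
theorem exists_diagonalAverage (hL : 0 < L) {g : Config N → ℂ} (hg : Continuous g)
    (hreal : ∀ X, g X = (‖g X‖ : ℂ))
    (hper : ∀ (X : Config N) (i : Fin N) (k : Fin 3),
      g (X + Pi.single i (EuclideanSpace.single k L)) = g X) :
    ∃ A : Config N → ℂ, Continuous A ∧ (∀ X, A X = (‖A X‖ : ℂ)) ∧
      (∀ (X : Config N) (i : Fin N) (k : Fin 3),
        A (X + Pi.single i (EuclideanSpace.single k L)) = A X) ∧
      (∀ (u : Space) (X : Config N), A (X + fun _ => u) = A X) ∧
      (∀ (h : Config N → ℂ), Continuous h → ∀ C : ℝ≥0∞,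
        (∀ u : Space, ∫⁻ X in cellN N L, (‖h X - g (X + fun _ => u)‖₊ : ℝ≥0∞) ^ 2 ≤ C) →
        ∫⁻ X in cellN N L, (‖h X - A X‖₊ : ℝ≥0∞) ^ 2 ≤ C) := by
  -- the volume of the one-particle cell and the averaging weight
  set V : ℝ := L ^ 3 with hV
  have hV0 : 0 < V := by positivity
  have hvol : volume (cellN 1 L) = ENNReal.ofReal V := by
    rw [volume_cellN, pow_one, ← ENNReal.ofReal_pow hL.le]
  have hVe0 : ENNReal.ofReal V ≠ 0 := (ENNReal.ofReal_pos.2 hV0).ne'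
  have hVetop : ENNReal.ofReal V ≠ ⊤ := ENNReal.ofReal_ne_top
  haveI : IsFiniteMeasure (volume.restrict (cellN 1 L)) :=
    ⟨by rw [Measure.restrict_apply_univ, hvol]; exact ENNReal.ofReal_lt_top⟩
  -- the integrand `F X U = g (X + (U 0, …, U 0))`
  set F : Config N → Config 1 → ℂ := fun X U => g (X + fun _ => U 0) with hF
  have hdiag : Continuous fun U : Config 1 => (fun _ : Fin N => U 0) :=
    continuous_pi fun _ => continuous_apply 0
  have hFc : Continuous (Function.uncurry F) :=
    hg.comp (continuous_fst.add (hdiag.comp continuous_snd))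
  have hFX : ∀ X, Continuous (F X) := fun X => hg.comp (continuous_const.add hdiag)
  set A : Config N → ℂ := fun X => (V⁻¹ : ℂ) * ∫ U in cellN 1 L, F X U with hA
  refine ⟨A, continuous_const.mul (continuous_setIntegral_cellN_one hFc L), fun X => ?_,
    fun X i k => ?_, fun u X => ?_, fun h hh C hC => ?_⟩
  · -- real non-negative
    have h1 : ∫ U in cellN 1 L, F X U = ((∫ U in cellN 1 L, ‖F X U‖ : ℝ) : ℂ) := by
      rw [← integral_complex_ofReal]
      exact integral_congr_ae (Eventually.of_forall fun U => hreal _)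
    have hnn : 0 ≤ ∫ U in cellN 1 L, ‖F X U‖ := integral_nonneg fun U => norm_nonneg _
    show (V⁻¹ : ℂ) * (∫ U in cellN 1 L, F X U) = (‖(V⁻¹ : ℂ) * ∫ U in cellN 1 L, F X U‖ : ℂ)
    rw [h1, ← Complex.ofReal_inv, ← Complex.ofReal_mul, Complex.norm_real,
      Real.norm_of_nonneg (mul_nonneg (inv_nonneg.2 hV0.le) hnn)]
  · -- periodic in every particle
    show (V⁻¹ : ℂ) * (∫ U in cellN 1 L, g (X + Pi.single i (EuclideanSpace.single k L) + fun _ => U 0)) =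
      (V⁻¹ : ℂ) * ∫ U in cellN 1 L, g (X + fun _ => U 0)
    congr 1
    refine integral_congr_ae (Eventually.of_forall fun U => ?_)
    show g (X + Pi.single i (EuclideanSpace.single k L) + fun _ => U 0) = g (X + fun _ => U 0)
    rw [add_right_comm, hper]
  · -- invariant under common translations: the `U`-integrand is periodic, shift the cell by `(u)`
    set G : Config 1 → ℂ := fun U => g (X + fun _ => U 0) with hG
    have hGc : Continuous G := hFX X
    have hGper : ∀ (U : Config 1) (i : Fin 1) (k : Fin 3),
        G (U + Pi.single i (EuclideanSpace.single k L)) = G U := by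
      intro U i k
      obtain rfl : i = 0 := Subsingleton.elim _ _
      simp only [hG]
      rw [const_apply_add_single, ← add_assoc, apply_add_const_single_of_periodic hper]
    have key : ∀ U : Config 1, g (X + (fun _ => u) + fun _ => U 0) = G (U + fun _ => u) := by
      intro U
      simp only [hG]
      congr 1
      funext j
      simp only [Pi.add_apply]
      abel
    show (V⁻¹ : ℂ) * (∫ U in cellN 1 L, g (X + (fun _ => u) + fun _ => U 0)) =
      (V⁻¹ : ℂ) * ∫ U in cellN 1 L, g (X + fun _ => U 0)
    congr 1
    calc (∫ U in cellN 1 L, g (X + (fun _ => u) + fun _ => U 0))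
        = ∫ U in cellN 1 L, G (U + fun _ => u) :=
          integral_congr_ae (Eventually.of_forall fun U => key U)
      _ = ∫ U in cellN 1 L, G U :=
          setIntegral_cellN_comp_add_of_periodic hL hGc.aestronglyMeasurable hGper _
  · -- Jensen in `L²(cell)`: pointwise Cauchy–Schwarz in `U`, then Tonelli
    have hVn : (‖(V⁻¹ : ℂ)‖₊ : ℝ≥0∞) = (ENNReal.ofReal V)⁻¹ := by
      rw [← enorm_eq_nnnorm, ← ofReal_norm, ← Complex.ofReal_inv, Complex.norm_real,
        Real.norm_of_nonneg (inv_nonneg.2 hV0.le), ENNReal.ofReal_inv_of_pos hV0]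
    -- pointwise: `|h X - A X|² ≤ V⁻¹ ∫_U |h X - F X U|²`
    have hpt : ∀ X, (‖h X - A X‖₊ : ℝ≥0∞) ^ 2 ≤
        (ENNReal.ofReal V)⁻¹ * ∫⁻ U in cellN 1 L, (‖h X - F X U‖₊ : ℝ≥0∞) ^ 2 := by
      intro X
      have hint : Integrable (F X) (volume.restrict (cellN 1 L)) := integrableOn_cellN (hFX X) L
      -- `h X - A X = V⁻¹ ∫_U (h X - F X U)`
      have hsub : h X - A X = (V⁻¹ : ℂ) * ∫ U in cellN 1 L, (h X - F X U) := by
        rw [integral_sub (integrable_const _) hint, setIntegral_const, measureReal_def, hvol,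
          ENNReal.toReal_ofReal hV0.le, mul_sub]
        show h X - (V⁻¹ : ℂ) * (∫ U in cellN 1 L, F X U) =
          (V⁻¹ : ℂ) * (V • h X) - (V⁻¹ : ℂ) * ∫ U in cellN 1 L, F X U
        rw [Complex.real_smul, ← mul_assoc, ← Complex.ofReal_inv, ← Complex.ofReal_mul,
          inv_mul_cancel₀ hV0.ne', Complex.ofReal_one, one_mul]
      have hmeas : AEMeasurable (fun U => (‖h X - F X U‖₊ : ℝ≥0∞)) (volume.restrict (cellN 1 L)) :=
        (continuous_const.sub (hFX X)).measurable.nnnorm.coe_nnreal_ennreal.aemeasurable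
      calc (‖h X - A X‖₊ : ℝ≥0∞) ^ 2
          = ((ENNReal.ofReal V)⁻¹ * (‖∫ U in cellN 1 L, (h X - F X U)‖₊ : ℝ≥0∞)) ^ 2 := by
            rw [hsub, nnnorm_mul, ENNReal.coe_mul, hVn]
        _ ≤ ((ENNReal.ofReal V)⁻¹ * ∫⁻ U in cellN 1 L, (‖h X - F X U‖₊ : ℝ≥0∞)) ^ 2 := by
            gcongr
            exact enorm_integral_le_lintegral_enorm _
        _ = (ENNReal.ofReal V)⁻¹ ^ 2 * (∫⁻ U in cellN 1 L, (‖h X - F X U‖₊ : ℝ≥0∞) * 1) ^ 2 := by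
            rw [mul_pow]
            simp only [mul_one]
        _ ≤ (ENNReal.ofReal V)⁻¹ ^ 2 * ((∫⁻ _ in cellN 1 L, (1 : ℝ≥0∞)) *
              ∫⁻ U in cellN 1 L, (‖h X - F X U‖₊ : ℝ≥0∞) ^ 2 * 1) := by
            gcongr
            exact lintegral_mul_sq_le_mul_lintegral_sq_mul _ aemeasurable_const hmeas
        _ = (ENNReal.ofReal V)⁻¹ * ∫⁻ U in cellN 1 L, (‖h X - F X U‖₊ : ℝ≥0∞) ^ 2 := by
            simp only [mul_one]
            rw [setLIntegral_const, one_mul, hvol, sq, mul_assoc, ← mul_assoc ((ENNReal.ofReal V)⁻¹)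
              (ENNReal.ofReal V), ENNReal.inv_mul_cancel hVe0 hVetop, one_mul]
    -- integrate over the cell and exchange the integrals
    have hswap : AEMeasurable (Function.uncurry fun (X : Config N) (U : Config 1) =>
        (‖h X - F X U‖₊ : ℝ≥0∞) ^ 2) ((volume.restrict (cellN N L)).prod (volume.restrict (cellN 1 L))) :=
      ((hh.comp continuous_fst).sub hFc).measurable.nnnorm.coe_nnreal_ennreal.pow_const 2
        |>.aemeasurable
    calc ∫⁻ X in cellN N L, (‖h X - A X‖₊ : ℝ≥0∞) ^ 2
        ≤ ∫⁻ X in cellN N L, (ENNReal.ofReal V)⁻¹ * ∫⁻ U in cellN 1 L, (‖h X - F X U‖₊ : ℝ≥0∞) ^ 2 :=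
          lintegral_mono fun X => hpt X
      _ = (ENNReal.ofReal V)⁻¹ * ∫⁻ U in cellN 1 L, ∫⁻ X in cellN N L, (‖h X - F X U‖₊ : ℝ≥0∞) ^ 2 := by
          rw [lintegral_const_mul' _ _ (ENNReal.inv_ne_top.2 hVe0), lintegral_lintegral_swap hswap]
      _ ≤ (ENNReal.ofReal V)⁻¹ * ∫⁻ _ in cellN 1 L, C := by
          gcongr with U
          exact hC (U 0)
      _ = C := by
          rw [setLIntegral_const, hvol, mul_comm C, ← mul_assoc, ENNReal.inv_mul_cancel hVe0 hVetop,
            one_mul]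

end Summit.AtomisticToContinuum.BoseEinsteinCondensation.Theorems.ModeIdentification

end
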